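import Mathlib.Topology.MetricSpace.HolderNorm
import Mathlib.Analysis.Normed.Operator.BoundedLinearMaps
import Literature.Analysis.FunctionSpaces.HolderNorm
import HarnessLib

/-!
# Hölder calculus inequalities: products and compositions

Topic `Literature/Analysis/FunctionSpaces`. The elementary "calculus inequalities for Hölder
continuous functions" of Majda–Bertozzi, *Vorticity and Incompressible Flow* (CUP 2002), §4.1.1
**Lemma 4.1** (p. 126 of the held text: for `γ ∈ (0, 1]`,
`|XY|_γ ≤ |X|₀ |Y|_γ + |X|_γ |Y|₀` (4.16) and `‖XY‖_γ ≤ c ‖X‖_γ ‖Y‖_γ` (4.17), with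
`‖X‖_γ = |X|₀ + |X|_γ` (4.15)) and **Lemma 4.3**, (4.20) (p. 127:
`|f ∘ X|_γ ≤ |f|_γ |∇X|₀^γ`), in the language of Mathlib's `HolderWith` / `eHolderNorm` and of the
tree's `eSupNorm` / `MemBoundedHolder` (`HolderNorm.lean`). Products are taken through an
arbitrary continuous bilinear map `B : Y →L[ℝ] Z →L[ℝ] W` (pointwise scalar products, the
action `x ↦ A(x) v(x)` of operator-valued on vector-valued functions, composition of
operator-valued functions), so that the matrix products `∇_αX ω₀`, `∇v(X) ∇_αX` of §4.1–4.2 are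
covered; compositions are with Lipschitz maps (`|∇X|₀` is the Lipschitz constant of `X`).

## Contents (all proved)

* `holderWith_of_dist_le` — a `HolderWith` constructor from the real inequality
  `dist (f x) (f y) ≤ C dist x y ^ r` on pseudometric spaces (Mathlib has only the converse
  `HolderWith.dist_le`);
* `holderWith_clm_apply₂` — **(4.16)**: if `f`, `g` are `r`-Hölder with constants `Cf`, `Cg` and
  bounded by `Mf`, `Mg`, then `x ↦ B (f x) (g x)` is `r`-Hölder with constant
  `‖B‖ (Mf Cg + Cf Mg)`;
* `norm_clm_apply₂_le`, `memBoundedHolder_clm_apply₂` — the sup bound and **(4.17)**-closure: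
  `C^{0,r}_b` is closed under bilinear products;
* `holderWith_comp_lipschitzWith` — **(4.20)**: `f` `r`-Hölder with constant `C` and `g`
  `K`-Lipschitz give `f ∘ g` `r`-Hölder with constant `C K^r` (Mathlib `HolderWith.comp` with
  `holderWith_one`); `memBoundedHolder_comp_lipschitzWith`,
  `eBoundedHolderNorm_comp_lipschitzWith_le` — **(4.21)**-closure (the sup part,
  `|f ∘ g|₀ ≤ |f|₀`, is `eSupNorm_comp_le` of `TorusHolderBridge.lean`, inlined here).

## References

* A. J. Majda, A. L. Bertozzi, *Vorticity and Incompressible Flow* (CUP 2002), §4.1.1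
  Lemma 4.1 (4.16)–(4.17), Lemma 4.3 (4.20)–(4.21), pp. 126–127; proofs "straightforward and
  hence presented in the appendix". [MajdaBertozziCUP2002]
* D. Gilbarg, N. Trudinger, *Elliptic PDE of Second Order* (2001), §4.1, (4.7) (products).

Mathlib: `HolderWith.comp`, `HolderWith.add`, `HolderWith.smul` (constant scalars),
`holderWith_one` exist; the product of two Hölder functions and the `dist`-constructor do not
(searched `HolderWith.mul`, `of_dist`, in `Topology/MetricSpace/Holder*.lean`).
-/

noncomputable section

open Set Filter Topology

open scoped NNReal ENNReal

namespace Literature.Analysis.FunctionSpaces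

/-! ## A real-inequality constructor for `HolderWith` -/

section Constructor

variable {X Y : Type*} [PseudoMetricSpace X] [PseudoMetricSpace Y] {C r : ℝ≥0} {f : X → Y}

/-- **`HolderWith` from the real Hölder inequality** `dist (f x) (f y) ≤ C dist x y ^ r` on
pseudometric spaces (converse of Mathlib's `HolderWith.dist_le`). [folklore] -/
theorem holderWith_of_dist_le (h : ∀ x y, dist (f x) (f y) ≤ C * dist x y ^ (r : ℝ)) :
    HolderWith C r f := by
  intro x y
  rw [edist_dist, edist_dist, ENNReal.ofReal_rpow_of_nonneg dist_nonneg r.coe_nonneg,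
    ← ENNReal.ofReal_coe_nnreal, ← ENNReal.ofReal_mul C.coe_nonneg]
  exact ENNReal.ofReal_le_ofReal (h x y)

/-- The real Hölder inequality is equivalent to `HolderWith` on pseudometric spaces. [folklore] -/
theorem holderWith_iff_dist_le : HolderWith C r f ↔ ∀ x y, dist (f x) (f y) ≤ C * dist x y ^ (r : ℝ) :=
  ⟨fun h x y => h.dist_le x y, holderWith_of_dist_le⟩

end Constructor

/-! ## Products through a continuous bilinear map (Lemma 4.1) -/

section Bilinear

variable {X : Type*} [PseudoMetricSpace X]
variable {Y Z W : Type*} [NormedAddCommGroup Y] [NormedSpace ℝ Y] [NormedAddCommGroup Z]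
  [NormedSpace ℝ Z] [NormedAddCommGroup W] [NormedSpace ℝ W]
variable {r : ℝ≥0}

/-- The algebraic identity behind the product rule for differences:
`B a b − B a' b' = B a (b − b') + B (a − a') b'`. [folklore] -/
theorem clm_apply₂_sub_clm_apply₂ (B : Y →L[ℝ] Z →L[ℝ] W) (a a' : Y) (b b' : Z) :
    B a b - B a' b' = B a (b - b') + B (a - a') b' := by
  rw [map_sub, map_sub, sub_apply]
  abel

/-- **Majda–Bertozzi Lemma 4.1, (4.16): the product of bounded Hölder functions is Hölder**,
`|XY|_γ ≤ |X|₀ |Y|_γ + |X|_γ |Y|₀`, for the product through a continuous bilinear map `B`: if `f`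
is `r`-Hölder with constant `Cf` and bounded by `Mf`, and `g` is `r`-Hölder with constant `Cg`
and bounded by `Mg`, then `x ↦ B (f x) (g x)` is `r`-Hölder with constant `‖B‖ (Mf Cg + Cf Mg)`
(write `B(f x)(g x) − B(f y)(g y) = B(f x)(g x − g y) + B(f x − f y)(g y)`). [cite: MajdaBertozziCUP2002, §4.1.1 Lemma 4.1 (4.16) (p. 126)] -/
theorem holderWith_clm_apply₂ (B : Y →L[ℝ] Z →L[ℝ] W) {f : X → Y} {g : X → Z}
    {Cf Cg Mf Mg : ℝ≥0} (hf : HolderWith Cf r f) (hg : HolderWith Cg r g)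
    (hMf : ∀ x, ‖f x‖ ≤ Mf) (hMg : ∀ x, ‖g x‖ ≤ Mg) :
    HolderWith (‖B‖₊ * (Mf * Cg + Cf * Mg)) r (fun x => B (f x) (g x)) := by
  refine holderWith_of_dist_le fun x y => ?_
  have hd : 0 ≤ dist x y ^ (r : ℝ) := Real.rpow_nonneg dist_nonneg _
  have hfx : 0 ≤ ‖f x‖ := norm_nonneg _
  have h1 : ‖B (f x) (g x - g y)‖ ≤ ‖B‖ * Mf * (Cg * dist x y ^ (r : ℝ)) := by
    have := B.le_opNorm₂ (f x) (g x - g y)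
    refine this.trans ?_
    rw [← dist_eq_norm]
    gcongr
    · exact hMf x
    · exact hg.dist_le x y
  have h2 : ‖B (f x - f y) (g y)‖ ≤ ‖B‖ * (Cf * dist x y ^ (r : ℝ)) * Mg := by
    have := B.le_opNorm₂ (f x - f y) (g y)
    refine this.trans ?_
    rw [← dist_eq_norm]
    gcongr
    · exact hf.dist_le x y
    · exact hMg y
  rw [dist_eq_norm, clm_apply₂_sub_clm_apply₂]
  calc ‖B (f x) (g x - g y) + B (f x - f y) (g y)‖
      ≤ ‖B (f x) (g x - g y)‖ + ‖B (f x - f y) (g y)‖ := norm_add_le _ _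
    _ ≤ ‖B‖ * Mf * (Cg * dist x y ^ (r : ℝ)) + ‖B‖ * (Cf * dist x y ^ (r : ℝ)) * Mg :=
        add_le_add h1 h2
    _ = (‖B‖₊ * (Mf * Cg + Cf * Mg) : ℝ≥0) * dist x y ^ (r : ℝ) := by
        push_cast
        ring

omit [PseudoMetricSpace X] in
/-- **Sup bound for bilinear products**: `‖B (f x) (g x)‖ ≤ ‖B‖ Mf Mg`. [folklore] -/
theorem norm_clm_apply₂_le (B : Y →L[ℝ] Z →L[ℝ] W) {f : X → Y} {g : X → Z} {Mf Mg : ℝ}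
    (hMf : ∀ x, ‖f x‖ ≤ Mf) (hMg : ∀ x, ‖g x‖ ≤ Mg) (x : X) :
    ‖B (f x) (g x)‖ ≤ ‖B‖ * Mf * Mg := by
  have hMf0 : 0 ≤ Mf := (norm_nonneg _).trans (hMf x)
  calc ‖B (f x) (g x)‖ ≤ ‖B‖ * ‖f x‖ * ‖g x‖ := B.le_opNorm₂ (f x) (g x)
    _ ≤ ‖B‖ * Mf * Mg := by gcongr <;> first | exact hMf x | exact hMg x

/-- **Majda–Bertozzi Lemma 4.1, (4.17): `C^{0,r}_b` is closed under products** through a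
continuous bilinear map (bounded: `norm_clm_apply₂_le`; Hölder: `holderWith_clm_apply₂`). [cite: MajdaBertozziCUP2002, §4.1.1 Lemma 4.1 (4.17) (p. 126)] -/
theorem memBoundedHolder_clm_apply₂ (B : Y →L[ℝ] Z →L[ℝ] W) {f : X → Y} {g : X → Z}
    (hf : MemBoundedHolder r f) (hg : MemBoundedHolder r g) :
    MemBoundedHolder r (fun x => B (f x) (g x)) := by
  obtain ⟨⟨Mf, hMf⟩, ⟨Cf, hCf⟩⟩ := memBoundedHolder_iff.1 hf
  obtain ⟨⟨Mg, hMg⟩, ⟨Cg, hCg⟩⟩ := memBoundedHolder_iff.1 hg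
  -- nonnegative versions of the sup bounds
  have hMf' : ∀ x, ‖f x‖ ≤ ((⟨max Mf 0, le_max_right _ _⟩ : ℝ≥0) : ℝ) := fun x =>
    (hMf x).trans (le_max_left _ _)
  have hMg' : ∀ x, ‖g x‖ ≤ ((⟨max Mg 0, le_max_right _ _⟩ : ℝ≥0) : ℝ) := fun x =>
    (hMg x).trans (le_max_left _ _)
  refine memBoundedHolder_iff.2 ⟨⟨‖B‖ * max Mf 0 * max Mg 0, norm_clm_apply₂_le B hMf' hMg'⟩,
    (holderWith_clm_apply₂ B hCf hCg hMf' hMg').memHolder⟩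

/-- **Pointwise action of operator-valued on vector-valued Hölder functions**: for
`A : X → (Y →L[ℝ] Z)` and `v : X → Y` in `C^{0,r}_b`, `x ↦ A x (v x)` is in `C^{0,r}_b` (the case
`∇_αX(α) ω₀(α)` of Majda–Bertozzi (4.9); `B = id`). [folklore] -/
theorem MemBoundedHolder.clm_apply {A : X → Y →L[ℝ] Z} {v : X → Y} (hA : MemBoundedHolder r A)
    (hv : MemBoundedHolder r v) : MemBoundedHolder r (fun x => A x (v x)) :=
  memBoundedHolder_clm_apply₂ (ContinuousLinearMap.id ℝ (Y →L[ℝ] Z)) hA hv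

/-- **Pointwise composition of operator-valued Hölder functions**: for `A : X → (Z →L[ℝ] W)` and
`A' : X → (Y →L[ℝ] Z)` in `C^{0,r}_b`, `x ↦ (A x).comp (A' x)` is in `C^{0,r}_b` (the case
`∇v(X(α)) ∇_αX(α)` of Majda–Bertozzi (4.45); `B = compL`). [folklore] -/
theorem MemBoundedHolder.clm_comp {A : X → Z →L[ℝ] W} {A' : X → Y →L[ℝ] Z}
    (hA : MemBoundedHolder r A) (hA' : MemBoundedHolder r A') :
    MemBoundedHolder r (fun x => (A x).comp (A' x)) :=
  memBoundedHolder_clm_apply₂ (ContinuousLinearMap.compL ℝ Y Z W) hA hA'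

/-- **Pointwise scalar multiplication of Hölder functions**: for `c : X → ℝ` and `v : X → Y` in
`C^{0,r}_b`, `x ↦ c x • v x` is in `C^{0,r}_b` (`B = lsmul`). [folklore] -/
theorem MemBoundedHolder.smul_fun {c : X → ℝ} {v : X → Y} (hc : MemBoundedHolder r c)
    (hv : MemBoundedHolder r v) : MemBoundedHolder r (fun x => c x • v x) :=
  memBoundedHolder_clm_apply₂ (ContinuousLinearMap.lsmul ℝ ℝ (E := Y)) hc hv

/-- **Pointwise product of real Hölder functions** is in `C^{0,r}_b` (`B = mul`). [folklore] -/
theorem MemBoundedHolder.mul {c d : X → ℝ} (hc : MemBoundedHolder r c) (hd : MemBoundedHolder r d) :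
    MemBoundedHolder r (fun x => c x * d x) :=
  memBoundedHolder_clm_apply₂ (ContinuousLinearMap.mul ℝ ℝ) hc hd

end Bilinear

/-! ## Composition with Lipschitz maps (Lemma 4.3) -/

section Composition

variable {X Y Z : Type*} [PseudoEMetricSpace X] [PseudoEMetricSpace Y] [PseudoEMetricSpace Z]
variable {r : ℝ≥0}

/-- **Majda–Bertozzi Lemma 4.3, (4.20): composition with a Lipschitz map**,
`|f ∘ X|_γ ≤ |f|_γ |∇X|₀^γ`: if `f` is `r`-Hölder with constant `C` and `g` is `K`-Lipschitz then
`f ∘ g` is `r`-Hölder with constant `C K^r` (Mathlib `HolderWith.comp` with `holderWith_one`). [cite: MajdaBertozziCUP2002, §4.1.1 Lemma 4.3 (4.20) (p. 127)] -/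
theorem holderWith_comp_lipschitzWith {C K : ℝ≥0} {f : Y → Z} {g : X → Y} (hf : HolderWith C r f)
    (hg : LipschitzWith K g) : HolderWith (C * K ^ (r : ℝ)) r (f ∘ g) := by
  have h := hf.comp (holderWith_one.2 hg)
  rwa [mul_one] at h

/-- `MemHolder` is preserved by composition with a Lipschitz map. [folklore] -/
theorem memHolder_comp_lipschitzWith {K : ℝ≥0} {f : Y → Z} {g : X → Y} (hf : MemHolder r f)
    (hg : LipschitzWith K g) : MemHolder r (f ∘ g) := by
  obtain ⟨C, hC⟩ := hf
  exact (holderWith_comp_lipschitzWith hC hg).memHolder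

end Composition

section CompositionSeminorm

variable {X Y Z : Type*} [PseudoEMetricSpace X] [MetricSpace Y] [EMetricSpace Z]
variable {r : ℝ≥0}

/-- The Hölder seminorm of a composition of a Hölder function with a `K`-Lipschitz map:
`[f ∘ g]_r ≤ [f]_r K^r`. (For `f` not Hölder the inequality can fail when `K = 0`, whence the
hypothesis; `Y` metric and `Z` emetric as in Mathlib's `MemHolder.holderWith`.) [cite: MajdaBertozziCUP2002, §4.1.1 Lemma 4.3 (4.20) (p. 127)] -/
theorem eHolderNorm_comp_lipschitzWith_le {K : ℝ≥0} {f : Y → Z} {g : X → Y} (hf : MemHolder r f)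
    (hg : LipschitzWith K g) :
    eHolderNorm r (f ∘ g) ≤ eHolderNorm r f * (K : ℝ≥0∞) ^ (r : ℝ) := by
  have h := holderWith_comp_lipschitzWith hf.holderWith hg
  calc eHolderNorm r (f ∘ g) ≤ ((nnHolderNorm r f * K ^ (r : ℝ) : ℝ≥0) : ℝ≥0∞) := h.eHolderNorm_le
    _ = eHolderNorm r f * (K : ℝ≥0∞) ^ (r : ℝ) := by
      rw [ENNReal.coe_mul, hf.coe_nnHolderNorm_eq_eHolderNorm, ENNReal.coe_rpow_of_nonneg _ r.coe_nonneg]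

end CompositionSeminorm

section CompositionNormed

variable {X Y Z : Type*} [PseudoEMetricSpace X] [MetricSpace Y] [NormedAddCommGroup Z]
variable {r : ℝ≥0}

/-- **Majda–Bertozzi Lemma 4.3, (4.21): `C^{0,r}_b` is preserved by composition with a
Lipschitz map**, `‖f ∘ X‖_γ ≤ ‖f‖_γ (1 + |X|_{1,γ}^γ)` (sup part: `eSupNorm_comp_le`; Hölder part:
`holderWith_comp_lipschitzWith`). [cite: MajdaBertozziCUP2002, §4.1.1 Lemma 4.3 (4.21) (p. 127)] -/
theorem memBoundedHolder_comp_lipschitzWith {K : ℝ≥0} {f : Y → Z} {g : X → Y}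
    (hf : MemBoundedHolder r f) (hg : LipschitzWith K g) : MemBoundedHolder r (f ∘ g) := by
  obtain ⟨⟨M, hM⟩, hH⟩ := memBoundedHolder_iff.1 hf
  exact memBoundedHolder_iff.2 ⟨⟨M, fun x => hM (g x)⟩, memHolder_comp_lipschitzWith hH hg⟩

/-- The inhomogeneous Hölder norm of a composition with a `K`-Lipschitz map:
`‖f ∘ g‖_{C^{0,r}} ≤ |f|₀ + [f]_r K^r ≤ ‖f‖_{C^{0,r}} max(1, K^r)`; stated in the first, sharper
form. [cite: MajdaBertozziCUP2002, §4.1.1 Lemma 4.3 (4.21) (p. 127)] -/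
theorem eBoundedHolderNorm_comp_lipschitzWith_le {K : ℝ≥0} {f : Y → Z} {g : X → Y}
    (hf : MemHolder r f) (hg : LipschitzWith K g) :
    eBoundedHolderNorm r (f ∘ g) ≤ eSupNorm f + eHolderNorm r f * (K : ℝ≥0∞) ^ (r : ℝ) :=
  add_le_add (iSup_le fun x => enorm_le_eSupNorm f (g x)) (eHolderNorm_comp_lipschitzWith_le hf hg)

end CompositionNormed

end Literature.Analysis.FunctionSpaces
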